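import Mathlib.Analysis.InnerProductSpace.PiL2
import Mathlib.Topology.MetricSpace.Bounded
import Mathlib.Order.LiminfLimsup
import Mathlib.Data.Set.Card
import Mathlib.Data.Real.ENatENNReal
import Mathlib.Algebra.Group.Pointwise.Set.Basic
import Mathlib.Data.List.TFAE
import HarnessLib

/-!
# Meyer sets: the Lagarias–Meyer characterisation (Konieczny 2023, Theorem 1.1)

Topic `Literature/Geometry/DiscreteGeometry` (aperiodic order). Named fact vendored by a grounder for route
`AtomisticToContinuum/Crystallization/SumsetDoublingRigidity`: it grounds the "Meyer step" of the crux
`Summit.AtomisticToContinuum.Crystallization.Theses.SumsetDoublingRigidity.DoublingRungRigidity`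
(stmt-AtomisticToContinuum-16934: a saturated separated `X ⊂ ℝ³` whose sumset has density-doubling `< 2` on
large balls is periodic; intended proof "finite doubling ⇒ `X − X` uniformly discrete ⇒ `X ⊂ M + F` with `M`
cut-and-project ⇒ …"). Only the characterisation theorem is vendored; the threshold-2 periodicity statement of
the route has no printed counterpart.

## Source (J. Konieczny, *Characterisation of Meyer sets via the Freiman–Ruzsa theorem*, J. Number Theory
**253** (2023) 278–294, doi:10.1016/j.jnt.2023.06.012 = arXiv:2103.02289; verbatim from §1 and §2.2)

* §1, **Theorem 1.1.** "Let `d ≥ 1` and let `A ⊂ ℝᵈ` be a relatively dense set. Then the following conditions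
  are equivalent: (A) `D⁺(A − A) < ∞`; (B) `A − A` is uniformly discrete; (C) `A` is uniformly discrete and
  `A − A ⊂ A + F` for a finite set `F`; (D) `A ⊂ M + F` for a cut-and-project set `M` and a finite set `F`."
  "(B) ⇒ (C) was shown by Lagarias [Lagarias-1996] […] (A) ⇒ (C) […] by Lev and Olevskii […] (C) ⇒ (D) […]
  is a theorem of Meyer"; the paper reproves (A) ⇒ (D) (its Theorem 3.1) from the Freiman–Ruzsa theorem.
* §1: "`D⁺(A) = limsup_{R→∞} sup_{x∈ℝᵈ} (2R)^{-d} |{a ∈ A : ‖a − x‖_∞ < R}|`. […] A set `A` is relatively dense if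
  it intersects each ball of radius `R` for some `R > 0`, and it is uniformly discrete if for some `r > 0` each
  ball with radius `r` contains at most one point in `A`. A cut-and-project set takes the form
  `π₁(Γ ∩ (ℝᵈ × Ω))` for some lattice `Γ ⊂ ℝ^{d+e}` and bounded open set `Ω ⊂ ℝᵉ` and projection
  `π₁ : ℝ^{d+e} → ℝᵈ`."
* §2.2: "A lattice in `ℝᵈ` is a subgroup of `ℝᵈ` that is both relatively dense and (uniformly) discrete."

## Rendering

* `ℝᵈ` is `EuclideanSpace ℝ (Fin d)`; `ℝᵈ × ℝᵉ` is the product type (Mathlib's sup-product metric). Relative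
  density / uniform discreteness are metric notions stated over any metric space, exactly as on p. 5 of the
  paper (closed balls of radius `R` meet `A`; open `r`-balls about points of `A` contain no other point of `A`);
  they are insensitive to the choice among equivalent norms, as the paper notes ("the choice of the norm does
  not play a significant role").
* `D⁺` is rendered with the printed sup-norm boxes `∏ (xᵢ − R, xᵢ + R)` of volume `(2R)ᵈ`, valued in `ℝ≥0∞`
  (`Set.encard`, so an infinite box count is `⊤`, making `D⁺ < ⊤` faithful).
* "cut-and-project set" follows the §1 wording (lattice `Γ`, bounded open window `Ω`, any number `e ≥ 0` of
  internal dimensions); §2.2 of the paper works with discrete `Γ` and compact regular-closed `Ω` and shows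
  (Lemma 2.6) that for relatively dense `A` one may take `Γ` a lattice — for the containment `A ⊆ M + F` the two
  window conventions are interchangeable (enlarge a compact window to a bounded open one; close an open one).
* The four conditions are packaged with `List.TFAE`, as printed.

Deliberately NOT here: the quantitative Theorem 1.3 (`O(d log K)` internal dimensions), the Freiman–Ruzsa
theorem itself (Mathlib/PFR cover the finite-field and entropic forms; tree `PolynomialFreimanRuzsa_holds`),
Meyer's harmonious-set characterisations, and Machado's amenable/semisimple generalisations (Machado2025).
-/

namespace Literature.Geometry.DiscreteGeometry

open Set Filter
open scoped Pointwise ENNReal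

/-- `A` is **relatively dense** in the metric space `X`: for some `R > 0` every closed ball of radius `R`
meets `A` (Konieczny 2023, §2.2, p. 5; = condition (ii) of a Delone set). [cite: Konieczny2023, §2.2] -/
def IsRelativelyDense {X : Type*} [MetricSpace X] (A : Set X) : Prop :=
  ∃ R : ℝ, 0 < R ∧ ∀ x : X, (A ∩ Metric.closedBall x R).Nonempty

/-- `A` is **uniformly discrete** in the metric space `X`: for some `r > 0` the open `r`-ball about any point
of `A` contains no other point of `A`, i.e. distinct points of `A` are at distance `≥ r`
(Konieczny 2023, §2.2, p. 5). [cite: Konieczny2023, §2.2] -/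
def IsUniformlyDiscrete {X : Type*} [MetricSpace X] (A : Set X) : Prop :=
  ∃ r : ℝ, 0 < r ∧ ∀ a ∈ A, ∀ b ∈ A, a ≠ b → r ≤ dist a b

/-- The **upper uniform (asymptotic) density** of `A ⊂ ℝᵈ`,
`D⁺(A) = limsup_{R → ∞} sup_{x ∈ ℝᵈ} |A ∩ B_∞(x, R)| / (2R)ᵈ` with the sup-norm boxes
`B_∞(x, R) = ∏ᵢ (xᵢ − R, xᵢ + R)` (Konieczny 2023, §1 and §2.2), valued in `ℝ≥0∞`. [cite: Konieczny2023, §2.2] -/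
noncomputable def upperUniformDensity {d : ℕ} (A : Set (EuclideanSpace ℝ (Fin d))) : ℝ≥0∞ :=
  Filter.limsup (fun R : ℝ => ⨆ x : EuclideanSpace ℝ (Fin d),
      (({a : EuclideanSpace ℝ (Fin d) | a ∈ A ∧ ∀ i, |a i - x i| < R}).encard : ℝ≥0∞) /
        ENNReal.ofReal ((2 * R) ^ d)) Filter.atTop

/-- `M ⊂ ℝᵈ` is a **cut-and-project set** with `e` internal dimensions (Konieczny 2023, §1):
`M = π₁(Γ ∩ (ℝᵈ × Ω))` for a lattice `Γ ⊂ ℝᵈ × ℝᵉ` (a subgroup that is relatively dense and uniformly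
discrete, §2.2) and a bounded open window `Ω ⊂ ℝᵉ`. [cite: Konieczny2023, §1] -/
def IsCutAndProject (d e : ℕ) (M : Set (EuclideanSpace ℝ (Fin d))) : Prop :=
  ∃ Γ : AddSubgroup (EuclideanSpace ℝ (Fin d) × EuclideanSpace ℝ (Fin e)),
    IsRelativelyDense (Γ : Set (EuclideanSpace ℝ (Fin d) × EuclideanSpace ℝ (Fin e))) ∧
    IsUniformlyDiscrete (Γ : Set (EuclideanSpace ℝ (Fin d) × EuclideanSpace ℝ (Fin e))) ∧
    ∃ Ω : Set (EuclideanSpace ℝ (Fin e)), IsOpen Ω ∧ Bornology.IsBounded Ω ∧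
      M = Prod.fst '' ((Γ : Set (EuclideanSpace ℝ (Fin d) × EuclideanSpace ℝ (Fin e))) ∩ Prod.snd ⁻¹' Ω)

/-- **Konieczny 2023, Theorem 1.1** (the Lagarias–Meyer characterisation of Meyer sets; (B)⇒(C) Lagarias
1996, (C)⇒(D) Meyer 1972, (A)⇒(D) reproved from Freiman–Ruzsa as Theorem 3.1). Let `d ≥ 1` and let
`A ⊂ ℝᵈ` be relatively dense. Then the following are equivalent: (A) `D⁺(A − A) < ∞`; (B) `A − A` is
uniformly discrete; (C) `A` is uniformly discrete and `A − A ⊂ A + F` for a finite set `F`; (D) `A ⊂ M + F` for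
a cut-and-project set `M` and a finite set `F`. A set satisfying them is a *Meyer set*. Grounds the Meyer step
of `Summit.AtomisticToContinuum.Crystallization.Theses.SumsetDoublingRigidity.DoublingRungRigidity`
(stmt-AtomisticToContinuum-16934). [cite: Konieczny2023, Thm 1.1] -/
def Konieczny2023_thm_1_1 : Prop :=
  ∀ (d : ℕ), 1 ≤ d → ∀ (A : Set (EuclideanSpace ℝ (Fin d))), IsRelativelyDense A →
    List.TFAE
      [ upperUniformDensity (A - A) < ⊤,
        IsUniformlyDiscrete (A - A),
        IsUniformlyDiscrete A ∧ ∃ F : Set (EuclideanSpace ℝ (Fin d)), F.Finite ∧ A - A ⊆ A + F,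
        ∃ (e : ℕ) (M F : Set (EuclideanSpace ℝ (Fin d))), IsCutAndProject d e M ∧ F.Finite ∧ A ⊆ M + F ]

end Literature.Geometry.DiscreteGeometry
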